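import Mathlib
import Literature.Analysis.OperatorTheory.KernelEnergyMomentumPair
import Literature.MathematicalPhysics.QuantumFieldTheory.MirrorHalfSpaceClusters
import HarnessLib

/-!
# The OS Hilbert space of a mirror: transfer semigroup, in-plane translations, spectral measures

Topic `Literature/MathematicalPhysics/QuantumFieldTheory`.  Continuation of
`MirrorHalfSpaceClusters.lean`: the kernel-level Osterwalder–Schrader reconstruction of a correlation
family `S` in the frame of a hyperplane mirror `n^⊥` from `h : MirrorOSData S n`, by dot notation.

* `h.kmat`, `h.Space`, `h.gen` — the reproducing-kernel Hilbert space (Mathlib `RKHS.OfKernel`) of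
  the complexified mirror kernel `K(x, y) = S(θ_n x ⊔ y)`, with kernel vectors `h.gen x` of dense
  span and Gram matrix `K` (Moore–Aronszajn; `Literature.Analysis.OperatorTheory.KernelVectors`).
* `h.transfer n' hn' t = e^{-tH}` and `h.translate n' hn' a = e^{i a₁ P}` — the energy–momentum pair
  (`Literature.Analysis.OperatorTheory.IsEnergyMomentumPair`) obtained from the time shifts along `n`
  and the translations along a mirror direction `n' ⊥ n`
  (`KernelVectors.exists_isEnergyMomentumPair`: OS iteration for the contraction property,
  density for strong continuity); `h.isEnergyMomentumPair`, `h.transfer_lc`, `h.translate_lc`.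
* `clusterPairing S n' hn' c d t s = Σ_{x,y} conj(c_x) d_y K(x, y + s n' + (t∨0) n)` — the two-cluster
  functions of finitely supported complex functionals, with their algebra (sesquilinearity,
  `clusterPairing_single_single`, `clusterPairing_mapDomain`), the operator formula
  `clusterPairing c d t s = ⟪ψ_c, e^{-tH} e^{isP} ψ_d⟫` (`clusterPairing_eq_inner`), **Gram positivity at Euclidean
  points** `Σ γ̄_a γ_b pairing (c_a) (c_b) (t_a + t_b) (s_b - s_a) ≥ 0` (`clusterPairing_gram_nonneg`),
  **polarization** (`clusterPairing_polarization`), and the **joint spectral measure** of every `ψ_c`: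
  a finite measure `μ` on `ℝ²` carried by `{E ≥ 0}` with `clusterPairing c c t s = ∫ e^{-tE + isP} dμ`
  (`t ≥ 0`) and `μ(ℝ²) = ‖ψ_c‖²` (`exists_spectralMeasure`;
  `IsEnergyMomentumPair.exists_measure_inner_transfer_translate_eq_integral`).

NOT here: light cones, lattice normals, uniqueness of the measures.

## References
* K. Osterwalder, R. Schrader, Comm. Math. Phys. 31 (1973), §4.1. [folklore]
* J. Glimm, A. Jaffe, *Quantum Physics* (2nd ed. 1987), Thm. 6.1.3. [folklore]
* M. Reed, B. Simon, *Methods of Modern Mathematical Physics I*, Thm. VIII.12. [folklore]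
-/

noncomputable section

open scoped InnerProductSpace BigOperators ComplexConjugate
open Literature.Probability.LatticeModels Literature.Analysis.OperatorTheory Finset MeasureTheory Complex

namespace Literature.MathematicalPhysics.QuantumFieldTheory

/-! ### Two-cluster functions -/

section Pairing

variable {d : ℕ} (S : CorrFamily d) {n : EuclideanSpace ℝ (Fin d)} (n' : EuclideanSpace ℝ (Fin d))
  (hn' : ⟪n', n⟫_ℝ = 0)

/-- **The two-cluster function** of finitely supported complex functionals `c, c'` on the half-space
clusters of the mirror `n^⊥`, for the frame `(n, n')`:
`clusterPairing S n' hn' c c' t s = Σ_{x,y} conj(c_x) c'_y K(x, y + s n' + (t ∨ 0) n)` — the pointwise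
form of the matrix element `⟪ψ_c, e^{-tH} e^{isP} ψ_{c'}⟫` (Osterwalder–Schrader (4.3), (4.5)–(4.6)). [folklore] -/
def clusterPairing (c c' : HalfSpaceCluster d n →₀ ℂ) (t s : ℝ) : ℂ :=
  c.sum fun x a => c'.sum fun y b =>
    conj a * b * ((mirrorKernel S n x (HalfSpaceCluster.shift n' hn' t s y) : ℝ) : ℂ)

/-- Unfolding of `clusterPairing` as a double sum over the supports. [folklore] -/
theorem clusterPairing_eq_sum (c c' : HalfSpaceCluster d n →₀ ℂ) (t s : ℝ) :
    clusterPairing S n' hn' c c' t s = ∑ x ∈ c.support, ∑ y ∈ c'.support,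
      conj (c x) * c' y * ((mirrorKernel S n x (HalfSpaceCluster.shift n' hn' t s y) : ℝ) : ℂ) := rfl

/-- `clusterPairing` only depends on `t ∨ 0`. [folklore] -/
theorem clusterPairing_max (c c' : HalfSpaceCluster d n →₀ ℂ) (t s : ℝ) :
    clusterPairing S n' hn' c c' (max t 0) s = clusterPairing S n' hn' c c' t s := by
  simp only [clusterPairing, HalfSpaceCluster.shift_max]

/-- **Value on single clusters**: `clusterPairing δ_x δ_y t s = conj a · b · K(x, y + s n' + (t∨0) n)`. [folklore] -/
theorem clusterPairing_single_single (x y : HalfSpaceCluster d n) (a b : ℂ) (t s : ℝ) :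
    clusterPairing S n' hn' (Finsupp.single x a) (Finsupp.single y b) t s =
      conj a * b * ((mirrorKernel S n x (HalfSpaceCluster.shift n' hn' t s y) : ℝ) : ℂ) := by
  unfold clusterPairing
  rw [Finsupp.sum_single_index, Finsupp.sum_single_index] <;> simp

/-- **Relabelled functionals**: `clusterPairing (c ∘ f⁻¹) (c' ∘ g⁻¹) t s = Σ conj(c_x) c'_y K(f x, shift (g y))`.
[folklore] -/
theorem clusterPairing_mapDomain {Y Z : Type*} (f : Y → HalfSpaceCluster d n) (g : Z → HalfSpaceCluster d n)
    (c : Y →₀ ℂ) (c' : Z →₀ ℂ) (t s : ℝ) :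
    clusterPairing S n' hn' (Finsupp.mapDomain f c) (Finsupp.mapDomain g c') t s =
      ∑ x ∈ c.support, ∑ y ∈ c'.support,
        conj (c x) * c' y * ((mirrorKernel S n (f x) (HalfSpaceCluster.shift n' hn' t s (g y)) : ℝ) : ℂ) := by
  unfold clusterPairing
  rw [Finsupp.sum_mapDomain_index (fun _ => by simp) (fun x m₁ m₂ => ?_)]
  · refine Finset.sum_congr rfl fun x _ => ?_
    dsimp only
    rw [Finsupp.sum_mapDomain_index (fun _ => by simp) (fun y m₁ m₂ => by ring)]
    rfl
  · rw [← Finsupp.sum_add]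
    refine Finsupp.sum_congr fun y _ => ?_
    rw [map_add]; ring

/-- `clusterPairing` is additive in the first functional. [folklore] -/
theorem clusterPairing_add_left (c₁ c₂ c' : HalfSpaceCluster d n →₀ ℂ) (t s : ℝ) :
    clusterPairing S n' hn' (c₁ + c₂) c' t s = clusterPairing S n' hn' c₁ c' t s + clusterPairing S n' hn' c₂ c' t s := by
  unfold clusterPairing
  refine Finsupp.sum_add_index' (fun x => ?_) (fun x b₁ b₂ => ?_)
  · simp [Finsupp.sum]
  · rw [← Finsupp.sum_add]
    refine Finsupp.sum_congr fun y _ => ?_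
    rw [map_add]; ring

/-- `clusterPairing` is additive in the second functional. [folklore] -/
theorem clusterPairing_add_right (c c₁ c₂ : HalfSpaceCluster d n →₀ ℂ) (t s : ℝ) :
    clusterPairing S n' hn' c (c₁ + c₂) t s = clusterPairing S n' hn' c c₁ t s + clusterPairing S n' hn' c c₂ t s := by
  unfold clusterPairing
  rw [← Finsupp.sum_add]
  refine Finsupp.sum_congr fun x _ => ?_
  exact Finsupp.sum_add_index' (fun y => by simp) (fun y b₁ b₂ => by ring)

/-- `clusterPairing` is conjugate-homogeneous in the first functional. [folklore] -/
theorem clusterPairing_smul_left (a : ℂ) (c c' : HalfSpaceCluster d n →₀ ℂ) (t s : ℝ) :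
    clusterPairing S n' hn' (a • c) c' t s = conj a * clusterPairing S n' hn' c c' t s := by
  unfold clusterPairing
  rw [Finsupp.sum_smul_index' (fun x => by simp [Finsupp.sum]),
    Finsupp.mul_sum]
  refine Finsupp.sum_congr fun x _ => ?_
  rw [Finsupp.mul_sum]
  refine Finsupp.sum_congr fun y _ => ?_
  simp only [smul_eq_mul, map_mul]; ring

/-- `clusterPairing` is homogeneous in the second functional. [folklore] -/
theorem clusterPairing_smul_right (a : ℂ) (c c' : HalfSpaceCluster d n →₀ ℂ) (t s : ℝ) :
    clusterPairing S n' hn' c (a • c') t s = a * clusterPairing S n' hn' c c' t s := by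
  unfold clusterPairing
  rw [Finsupp.mul_sum]
  refine Finsupp.sum_congr fun x _ => ?_
  rw [Finsupp.sum_smul_index' (fun y => by simp), Finsupp.mul_sum]
  refine Finsupp.sum_congr fun y _ => ?_
  simp only [smul_eq_mul]; ring

/-- `clusterPairing` is odd in the first functional. [folklore] -/
theorem clusterPairing_neg_left (c c' : HalfSpaceCluster d n →₀ ℂ) (t s : ℝ) :
    clusterPairing S n' hn' (-c) c' t s = -clusterPairing S n' hn' c c' t s := by
  rw [show -c = (-1 : ℂ) • c by simp, clusterPairing_smul_left]; simp

/-- `clusterPairing` is odd in the second functional. [folklore] -/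
theorem clusterPairing_neg_right (c c' : HalfSpaceCluster d n →₀ ℂ) (t s : ℝ) :
    clusterPairing S n' hn' c (-c') t s = -clusterPairing S n' hn' c c' t s := by
  rw [show -c' = (-1 : ℂ) • c' by simp, clusterPairing_smul_right]; simp

/-- `clusterPairing` and subtraction in the first functional. [folklore] -/
theorem clusterPairing_sub_left (c₁ c₂ c' : HalfSpaceCluster d n →₀ ℂ) (t s : ℝ) :
    clusterPairing S n' hn' (c₁ - c₂) c' t s = clusterPairing S n' hn' c₁ c' t s - clusterPairing S n' hn' c₂ c' t s := by
  rw [sub_eq_add_neg, clusterPairing_add_left, clusterPairing_neg_left, sub_eq_add_neg]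

/-- `clusterPairing` and subtraction in the second functional. [folklore] -/
theorem clusterPairing_sub_right (c c₁ c₂ : HalfSpaceCluster d n →₀ ℂ) (t s : ℝ) :
    clusterPairing S n' hn' c (c₁ - c₂) t s = clusterPairing S n' hn' c c₁ t s - clusterPairing S n' hn' c c₂ t s := by
  rw [sub_eq_add_neg, clusterPairing_add_right, clusterPairing_neg_right, sub_eq_add_neg]

/-- **Polarization**: `clusterPairing c c'` in terms of the diagonal values of `c' + iᵏ c`. [folklore] -/
theorem clusterPairing_polarization (c c' : HalfSpaceCluster d n →₀ ℂ) (t s : ℝ) :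
    clusterPairing S n' hn' c c' t s = (1 / 4) * (clusterPairing S n' hn' (c' + c) (c' + c) t s -
      clusterPairing S n' hn' (c' - c) (c' - c) t s + I * clusterPairing S n' hn' (c' + I • c) (c' + I • c) t s -
      I * clusterPairing S n' hn' (c' - I • c) (c' - I • c) t s) := by
  simp only [clusterPairing_add_left, clusterPairing_add_right, clusterPairing_sub_left,
    clusterPairing_sub_right, clusterPairing_smul_left, clusterPairing_smul_right, Complex.conj_I]
  linear_combination ((1 / 2) * clusterPairing S n' hn' c c' t s - (1 / 2) * clusterPairing S n' hn' c' c t s) *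
    Complex.I_sq

end Pairing

namespace MirrorOSData

variable {d : ℕ} {S : CorrFamily d} {n : EuclideanSpace ℝ (Fin d)}

/-! ### The reproducing-kernel Hilbert space -/

/-- The complexified mirror kernel packaged as an operator-valued matrix `K(x, y) • 1` (the input
format of Mathlib's `RKHS.OfKernel`). [folklore] -/
@[nolint unusedArguments]
def kmat (_h : MirrorOSData S n) : Matrix (HalfSpaceCluster d n) (HalfSpaceCluster d n) (ℂ →L[ℂ] ℂ) :=
  Matrix.of fun x y => ((mirrorKernel S n x y : ℝ) : ℂ) • (1 : ℂ →L[ℂ] ℂ)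

variable (h : MirrorOSData S n)

/-- **The packaged kernel is positive semidefinite** (reflection positivity + symmetry). [folklore] -/
theorem posSemidef_kmat : h.kmat.PosSemidef :=
  KernelVectors.posSemidef_smul_one _ h.conj_mirrorKernel h.re_sum_sum_conj_nonneg

/-- The positivity fact as an instance (keyed on `h`). [folklore] -/
instance fact_posSemidef_kmat : Fact h.kmat.PosSemidef := ⟨h.posSemidef_kmat⟩

/-- **The OS Hilbert space of the mirror `n^⊥`**: the reproducing-kernel Hilbert space of the
mirror kernel (Moore–Aronszajn / GNS; it is the completion of the finitely supported functionals
modulo null vectors, Osterwalder–Schrader (4.4), Glimm–Jaffe Prop. 6.1.1). [folklore] -/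
abbrev Space : Type := RKHS.OfKernel h.kmat

/-- **The kernel vector `δ_x`** of a cluster. [folklore] -/
def gen (x : HalfSpaceCluster d n) : h.Space := RKHS.kerFun (RKHS.OfKernel h.kmat) x (1 : ℂ)

/-- **Gram identity** `⟪δ_x, δ_y⟫ = K(x, y)`. [folklore] -/
@[simp] theorem inner_gen_gen (x y : HalfSpaceCluster d n) :
    ⟪h.gen x, h.gen y⟫_ℂ = ((mirrorKernel S n x y : ℝ) : ℂ) :=
  haveI : Fact (Matrix.of fun x y : HalfSpaceCluster d n =>
      ((mirrorKernel S n x y : ℝ) : ℂ) • (1 : ℂ →L[ℂ] ℂ)).PosSemidef := h.fact_posSemidef_kmat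
  KernelVectors.inner_kerFun_one _ h.conj_mirrorKernel x y

/-- The kernel vectors have dense span. [folklore] -/
theorem denseRange_lc_gen : DenseRange (Finsupp.linearCombination ℂ h.gen) :=
  KernelVectors.denseRange_lc_kerFun_one h.kmat

/-- **The OS vector `ψ_c = Σ c_x δ_x`** of a finitely supported complex functional. [folklore] -/
def vec : (HalfSpaceCluster d n →₀ ℂ) →ₗ[ℂ] h.Space := Finsupp.linearCombination ℂ h.gen

/-- Unfolding of `vec`. [folklore] -/
theorem vec_apply (c : HalfSpaceCluster d n →₀ ℂ) : h.vec c = Finsupp.linearCombination ℂ h.gen c := rfl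

/-! ### The energy–momentum pair of the frame `(n, n')` -/

section Pair

variable (n' : EuclideanSpace ℝ (Fin d)) (hn' : ⟪n', n⟫_ℝ = 0)

/-- The hypotheses of `KernelVectors.exists_isEnergyMomentumPair` for the time shifts
`σ_t = shift t 0` and the in-plane translations `ρ_a = shift 0 (a 1)`. [folklore] -/
theorem exists_pair :
    ∃ (T : ℝ → h.Space →L[ℂ] h.Space) (U : EuclideanSpace ℝ (Fin 2) → h.Space →L[ℂ] h.Space),
      IsEnergyMomentumPair T U ∧
      (∀ t c, T t (Finsupp.linearCombination ℂ h.gen c) =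
        Finsupp.linearCombination ℂ h.gen (Finsupp.mapDomain (HalfSpaceCluster.shift n' hn' t 0) c)) ∧
      ∀ a c, U a (Finsupp.linearCombination ℂ h.gen c) =
        Finsupp.linearCombination ℂ h.gen (Finsupp.mapDomain (HalfSpaceCluster.shift n' hn' 0 (a 1)) c) := by
  have hT := h.translationInvariant
  refine KernelVectors.exists_isEnergyMomentumPair h.gen h.denseRange_lc_gen
    (fun t => HalfSpaceCluster.shift n' hn' t 0) (fun a => HalfSpaceCluster.shift n' hn' 0 (a 1))
    (fun x => HalfSpaceCluster.shift_zero_zero n' hn' x) (fun s t hs ht x => ?_) (fun t x => ?_)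
    (fun t x y => ?_) (fun x y => ?_) (fun x y => ?_) (fun x => ?_) (fun a b x => ?_) (fun a t x => ?_)
    (fun a x y => ?_) (fun x y => ?_) (fun s x => ?_)
  · rw [HalfSpaceCluster.shift_shift n' hn' hs ht, add_zero]
  · exact (HalfSpaceCluster.shift_max n' hn' t 0 x).symm
  · rw [inner_gen_gen, inner_gen_gen, mirrorKernel_shift_time hT]
  · obtain ⟨C, hC⟩ := h.kernel_bdd x y
    refine ⟨C, fun t => ?_⟩
    rw [inner_gen_gen, Complex.norm_real, Real.norm_eq_abs]
    have hpos : 0 ≤ ⟪max t 0 • n, n⟫_ℝ := by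
      rw [real_inner_smul_left]; exact mul_nonneg (le_max_right _ _) real_inner_self_nonneg
    have := hC (max t 0) (le_max_right _ _) hpos
    rwa [HalfSpaceCluster.shift, HalfSpaceCluster.translate_congr y _ hpos (by simp)]
  · simp only [inner_gen_gen]
    have h1 : Continuous fun t : ℝ => ((t, (0 : ℝ)) : ℝ × ℝ) := by fun_prop
    have h2 := (h.kernel_cont n' hn' x y).comp h1
    simp only [Function.comp_def] at h2
    exact Complex.continuous_ofReal.comp h2
  · exact HalfSpaceCluster.shift_zero_zero n' hn' x
  · rw [HalfSpaceCluster.shift_shift n' hn' le_rfl le_rfl, add_zero, PiLp.add_apply]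
  · have e : ∀ b : HalfSpaceCluster d n, HalfSpaceCluster.shift n' hn' t 0 b =
        HalfSpaceCluster.shift n' hn' (max t 0) 0 b := fun b => (HalfSpaceCluster.shift_max n' hn' t 0 b).symm
    rw [e, e, HalfSpaceCluster.shift_shift n' hn' le_rfl (le_max_right _ _),
      HalfSpaceCluster.shift_shift n' hn' (le_max_right _ _) le_rfl, zero_add, add_zero, zero_add, add_zero]
  · rw [inner_gen_gen, inner_gen_gen, mirrorKernel_shift_space hT]
  · simp only [inner_gen_gen]
    have h1 : Continuous fun a : EuclideanSpace ℝ (Fin 2) => (((0 : ℝ), a 1) : ℝ × ℝ) := by fun_prop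
    have h2 := (h.kernel_cont n' hn' x y).comp h1
    simp only [Function.comp_def] at h2
    exact Complex.continuous_ofReal.comp h2
  · have : (EuclideanSpace.single (0 : Fin 2) s) 1 = 0 := by simp
    rw [this]
    exact HalfSpaceCluster.shift_zero_zero n' hn' x

/-- **The transfer semigroup `e^{-tH}` of the frame `n`** (time shifts along `n`;
Glimm–Jaffe Thm. 6.1.3). [folklore] -/
def transfer : ℝ → h.Space →L[ℂ] h.Space := (h.exists_pair n' hn').choose

/-- **The in-plane translation group `e^{i a₁ P}`** along `n'` (indexed by `a ∈ ℝ²`, trivial in the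
coordinate `a₀`; Osterwalder–Schrader (4.5)). [folklore] -/
def translate : EuclideanSpace ℝ (Fin 2) → h.Space →L[ℂ] h.Space := (h.exists_pair n' hn').choose_spec.choose

/-- `(e^{-tH}, e^{iaP})` is an energy–momentum pair. [folklore] -/
theorem isEnergyMomentumPair : IsEnergyMomentumPair (h.transfer n' hn') (h.translate n' hn') :=
  (h.exists_pair n' hn').choose_spec.choose_spec.1

/-- `e^{-tH}` relabels kernel vectors by the time shift. [folklore] -/
theorem transfer_lc (t : ℝ) (c : HalfSpaceCluster d n →₀ ℂ) :
    h.transfer n' hn' t (Finsupp.linearCombination ℂ h.gen c) =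
      Finsupp.linearCombination ℂ h.gen (Finsupp.mapDomain (HalfSpaceCluster.shift n' hn' t 0) c) :=
  (h.exists_pair n' hn').choose_spec.choose_spec.2.1 t c

/-- `e^{iaP}` relabels kernel vectors by the spatial shift. [folklore] -/
theorem translate_lc (a : EuclideanSpace ℝ (Fin 2)) (c : HalfSpaceCluster d n →₀ ℂ) :
    h.translate n' hn' a (Finsupp.linearCombination ℂ h.gen c) =
      Finsupp.linearCombination ℂ h.gen (Finsupp.mapDomain (HalfSpaceCluster.shift n' hn' 0 (a 1)) c) :=
  (h.exists_pair n' hn').choose_spec.choose_spec.2.2 a c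

/-- `e^{-tH} e^{isP} ψ_c = ψ_{shift t s c}` for `t ≥ 0`. [folklore] -/
theorem transfer_translate_vec {t : ℝ} (ht : 0 ≤ t) (s : ℝ) (c : HalfSpaceCluster d n →₀ ℂ) :
    h.transfer n' hn' t (h.translate n' hn' (EuclideanSpace.single 1 s) (h.vec c)) =
      h.vec (Finsupp.mapDomain (HalfSpaceCluster.shift n' hn' t s) c) := by
  rw [vec_apply, translate_lc, transfer_lc, ← Finsupp.mapDomain_comp, vec_apply]
  congr 2
  funext x
  simp only [Function.comp_apply, PiLp.single_apply, if_true]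
  rw [HalfSpaceCluster.shift_shift n' hn' ht le_rfl, add_zero, zero_add]

/-! ### Two-cluster functions as matrix elements -/

/-- **The operator formula** `clusterPairing c c' t s = ⟪ψ_c, e^{-tH} e^{isP} ψ_{c'}⟫` (`t ≥ 0`). [folklore] -/
theorem pairing_eq_inner {t : ℝ} (ht : 0 ≤ t) (s : ℝ) (c c' : HalfSpaceCluster d n →₀ ℂ) :
    clusterPairing S n' hn' c c' t s =
      ⟪h.vec c, h.transfer n' hn' t (h.translate n' hn' (EuclideanSpace.single 1 s) (h.vec c'))⟫_ℂ := by
  rw [transfer_translate_vec _ _ _ ht, vec_apply, vec_apply, KernelVectors.inner_lc_lc_mapDomain]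
  simp only [inner_gen_gen]
  rfl

/-- The operator formula for all real `t` (time `t ∨ 0`). [folklore] -/
theorem pairing_eq_inner' (t s : ℝ) (c c' : HalfSpaceCluster d n →₀ ℂ) :
    clusterPairing S n' hn' c c' t s =
      ⟪h.vec c, h.transfer n' hn' (max t 0) (h.translate n' hn' (EuclideanSpace.single 1 s) (h.vec c'))⟫_ℂ := by
  rw [← clusterPairing_max, h.pairing_eq_inner n' hn' (le_max_right _ _)]

/-! ### Gram positivity at Euclidean points -/

include h in
open scoped ComplexOrder in
/-- **Gram positivity at Euclidean points**: for `t_a ≥ 0`,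
`Σ_{ab} γ̄_a γ_b pairing (c_a) (c_b) (t_a + t_b) (s_b - s_a) = ‖Σ_a γ_a e^{-t_aH} e^{is_aP} ψ_{c_a}‖² ≥ 0`
(`e^{-tH}` symmetric with the semigroup law, `e^{isP}` unitary, the two commute). [folklore] -/
theorem pairing_gram_nonneg {m : ℕ} (c : Fin m → (HalfSpaceCluster d n →₀ ℂ)) (t s : Fin m → ℝ)
    (γ : Fin m → ℂ) (ht : ∀ a, 0 ≤ t a) :
    0 ≤ ∑ a, ∑ b, conj (γ a) * γ b * clusterPairing S n' hn' (c a) (c b) (t a + t b) (s b - s a) := by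
  have hP := h.isEnergyMomentumPair n' hn'
  set φ : Fin m → h.Space := fun a =>
    h.transfer n' hn' (t a) (h.translate n' hn' (EuclideanSpace.single 1 (s a)) (h.vec (c a))) with hφ
  have key : ∀ a b, clusterPairing S n' hn' (c a) (c b) (t a + t b) (s b - s a) = ⟪φ a, φ b⟫_ℂ := by
    intro a b
    have hsingle : EuclideanSpace.single (1 : Fin 2) (s b - s a) =
        EuclideanSpace.single 1 (-s a) + EuclideanSpace.single 1 (s b) := by
      rw [euclideanSingle_add_single]; ring_nf
    rw [h.pairing_eq_inner n' hn' (add_nonneg (ht a) (ht b)), hP.transfer_add (ht a) (ht b), hsingle,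
      hP.translate_add]
    simp only [mul_apply_eq_comp]
    have hsymm : ∀ u v : h.Space, ⟪u, h.transfer n' hn' (t a) v⟫_ℂ = ⟪h.transfer n' hn' (t a) u, v⟫_ℂ :=
      fun u v =>
      ((ContinuousLinearMap.isSelfAdjoint_iff_isSymmetric.1 (hP.isSelfAdjoint_transfer (ht a))) u v).symm
    have hcomm : ∀ v : h.Space, h.transfer n' hn' (t b) (h.translate n' hn' (EuclideanSpace.single 1 (-s a)) v) =
        h.translate n' hn' (EuclideanSpace.single 1 (-s a)) (h.transfer n' hn' (t b) v) := fun v => by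
      have := congrArg (fun A : h.Space →L[ℂ] h.Space => A v) (hP.commute (ht b) (EuclideanSpace.single 1 (-s a))).eq
      simpa using this
    have hcomm' : ∀ v : h.Space, h.translate n' hn' (EuclideanSpace.single 1 (s a)) (h.transfer n' hn' (t a) v) =
        h.transfer n' hn' (t a) (h.translate n' hn' (EuclideanSpace.single 1 (s a)) v) := fun v => by
      have := congrArg (fun A : h.Space →L[ℂ] h.Space => A v) (hP.commute (ht a) (EuclideanSpace.single 1 (s a))).eq
      simpa using this.symm
    have hstar : h.translate n' hn' (EuclideanSpace.single 1 (-s a)) =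
        ContinuousLinearMap.adjoint (h.translate n' hn' (EuclideanSpace.single 1 (s a))) := by
      rw [← ContinuousLinearMap.star_eq_adjoint, hP.star_translate]
      congr 1
      ext i
      simp only [PiLp.single_apply, PiLp.neg_apply]
      split_ifs <;> simp
    rw [hsymm, hcomm, hstar, ContinuousLinearMap.adjoint_inner_right, hcomm']
  simp_rw [key]
  have hsum : (∑ a, ∑ b, conj (γ a) * γ b * ⟪φ a, φ b⟫_ℂ) = ⟪∑ a, γ a • φ a, ∑ b, γ b • φ b⟫_ℂ := by
    rw [sum_inner]
    refine Finset.sum_congr rfl fun a _ => ?_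
    rw [inner_sum]
    refine Finset.sum_congr rfl fun b _ => ?_
    rw [inner_smul_left, inner_smul_right]
    ring
  rw [hsum, inner_self_eq_norm_sq_to_K]
  exact Complex.sq_nonneg_iff.mpr rfl

/-! ### The joint spectral measures -/

include h in
/-- **The joint spectral measure of `ψ_c`**: a finite measure `μ` on `ℝ²` carried by `{E ≥ 0}`
with `clusterPairing c c t s = ∫ e^{-tE + isP} dμ(E, P)` for `t ≥ 0` and `μ(ℝ²) = ‖ψ_c‖² = Re pairing c c 0 0`
(`IsEnergyMomentumPair.exists_measure_inner_transfer_translate_eq_integral`). [folklore] -/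
theorem exists_spectralMeasure (c : HalfSpaceCluster d n →₀ ℂ) :
    ∃ μ : Measure (EuclideanSpace ℝ (Fin 2)), IsFiniteMeasure μ ∧ μ {p | p 0 < 0} = 0 ∧
      (∀ t : ℝ, 0 ≤ t → ∀ s : ℝ,
        clusterPairing S n' hn' c c t s = ∫ p, cexp (-((t : ℂ) * p 0) + I * (s : ℂ) * p 1) ∂μ) ∧
      μ.real Set.univ = (clusterPairing S n' hn' c c 0 0).re := by
  obtain ⟨μ, hfin, h0, hrep⟩ :=
    (h.isEnergyMomentumPair n' hn').exists_measure_inner_transfer_translate_eq_integral (h.vec c)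
  have hrep' : ∀ t : ℝ, 0 ≤ t → ∀ s : ℝ,
      clusterPairing S n' hn' c c t s = ∫ p, cexp (-((t : ℂ) * p 0) + I * (s : ℂ) * p 1) ∂μ := by
    intro t ht s
    rw [h.pairing_eq_inner n' hn' ht, hrep t ht (EuclideanSpace.single 1 s) (by simp)]
    refine integral_congr_ae (Filter.Eventually.of_forall fun p => ?_)
    simp only [EuclideanSpace.inner_single_left, conj_trivial]
    congr 1
    push_cast
    ring
  refine ⟨μ, hfin, h0, hrep', ?_⟩
  have h00 := hrep' 0 le_rfl 0
  simp only [Complex.ofReal_zero, zero_mul, neg_zero, mul_zero, zero_add, Complex.exp_zero,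
    integral_const, Complex.real_smul, mul_one] at h00
  rw [h00, Complex.ofReal_re]

end Pair

end MirrorOSData

end Literature.MathematicalPhysics.QuantumFieldTheory
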